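import Summits.AtomisticToContinuum.Crystallization.Theses.PerronTransitivity
import Summits.AtomisticToContinuum.Crystallization.Theorems.IsometryAtomsMinimisingLawsHaveAtomsWeightedClusterIneq
import Summits.AtomisticToContinuum.Crystallization.Theorems.IsometryAtomsMinimisingLawsHaveAtomsPalmCopositivity
import Summits.AtomisticToContinuum.Crystallization.Theorems.IsometryAtomsMinimisingLawsHaveAtomsRootEnergyLeOfCopositivity
import Summits.AtomisticToContinuum.Crystallization.Theorems.IsometryAtomsMinimisingLawsHaveAtomsAllSitesOfRoot
import HarnessLib

/-!
# THE BRIDGE of line `perron_transfer` (crux `IsometryAtoms.MinimisingLawsHaveAtoms`, stmt-AtomisticToContinuum-15776):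
# K* makes minimising point-stationary Lennard-Jones laws almost surely sitewise `2e*`-bound

**Theorem** (`stub_palmEnergyTransitive`, the registered bridge of the line, here PROVED).  Let `P` be a probability
law on rooted configurations of `ℝ³` which is almost surely a rooted `δ`-hard-core counting measure, point-stationary
(Mecke identity) and minimising, `E_P[h] ≤ e* = ⨅_Q e(Q)` (`h = ½ Σ_y V_LJ(‖y‖)`).  If the COPOSITIVE FLOOR K* holds
(`PerronTransitivity.NoFractionalGain`, stmt-AtomisticToContinuum-15098: `2e* Σ cᵢ² ≤ Σ_{i≠j} cᵢcⱼ V_LJ(dist xᵢ xⱼ)`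
for every finite configuration and weights `c ≥ 0`), then almost surely EVERY site `p` of the sample `S`
(`μ = count|S`, `0 ∈ S`) is bound by at least `2|e*|`: `Σ'_{q ∈ S, q ≠ p} V_LJ(dist p q) ≤ 2e*`.

**Proof** = composition of the four landed pieces: the weighted cluster inequality (`stub_weightedClusterIneq`,
p172476) fed with K* ⇒ Palm copositivity by the weighted ball-centre mass transport (`stub_palmCopositivity`,
p172647) ⇒ first variation at `w = 1 - s·1{h' > e*}`: `h ≤ e*` a.s. (`stub_rootEnergyLeOfCopositivity`, p172720) ⇒
everything shows at the root (`stub_allSitesOfRoot`, p172481).  This is the law-level twin of the proved finite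
statement `FractionalGainGivesTransitivity` (stmt-15101); no periodic structure, intensity or ergodicity is used.
-/

namespace Summit.AtomisticToContinuum.Crystallization.Theorems.IsometryAtomsMinimisingLawsHaveAtoms

/-- **THE BRIDGE `stub_palmEnergyTransitive` (line `perron_transfer`): K* ⇒ minimising point-stationary hard-core
Lennard-Jones laws are a.s. sitewise `2e*`-bound.**  For `δ > 0` and a probability law `P` on configurations of `ℝ³`,
a.s. rooted `δ`-hard-core, point-stationary, with `E_P[rootEnergy V_LJ] ≤ ⨅_Q e(Q)`: `NoFractionalGain` implies that
`P`-a.s. `μ = count|S` with `0 ∈ S`, `S` `δ`-separated, and `Σ'_{q ∈ S, q ≠ p} V_LJ(dist p q) ≤ 2 ⨅_Q e(Q)` for every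
`p ∈ S`.  Composition of `stub_weightedClusterIneq`, `stub_palmCopositivity`, `stub_rootEnergyLeOfCopositivity`,
`stub_allSitesOfRoot`. [folklore] -/
theorem stub_palmEnergyTransitive :
    ∀ δ : ℝ, 0 < δ → ∀ P : MeasureTheory.Measure (MeasureTheory.Measure (EuclideanSpace ℝ (Fin 3))), MeasureTheory.IsProbabilityMeasure P → (∀ᵐ μ ∂P, Literature.Probability.Process.IsRootedHardCore δ μ) → Literature.Probability.Process.IsPointStationaryLaw P → (∫ μ, Literature.MathematicalPhysics.StatisticalMechanics.rootEnergy Literature.MathematicalPhysics.StatisticalMechanics.lennardJones μ ∂P) ≤ (⨅ Q : Literature.MathematicalPhysics.StatisticalMechanics.PeriodicConfiguration 3, Q.energyPerParticle Literature.MathematicalPhysics.StatisticalMechanics.lennardJones) → Summit.AtomisticToContinuum.Crystallization.Theses.PerronTransitivity.NoFractionalGain → ∀ᵐ μ ∂P, ∃ S : Set (EuclideanSpace ℝ (Fin 3)), (0 : EuclideanSpace ℝ (Fin 3)) ∈ S ∧ (∀ p ∈ S, ∀ q ∈ S, p ≠ q → δ ≤ dist p q) ∧ μ = (MeasureTheory.Measure.count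 : MeasureTheory.Measure (EuclideanSpace ℝ (Fin 3))).restrict S ∧ ∀ p ∈ S, ∑' q : {q : EuclideanSpace ℝ (Fin 3) // q ∈ S ∧ q ≠ p}, Literature.MathematicalPhysics.StatisticalMechanics.lennardJones (dist p q.1) ≤ 2 * ⨅ Q : Literature.MathematicalPhysics.StatisticalMechanics.PeriodicConfiguration 3, Q.energyPerParticle Literature.MathematicalPhysics.StatisticalMechanics.lennardJones := by
  intro δ hδ P hP hhc hst hE hK
  exact stub_allSitesOfRoot δ hδ P hhc hst
    (stub_rootEnergyLeOfCopositivity δ hδ P hP hhc hst hE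
      (stub_palmCopositivity (stub_weightedClusterIneq hK) δ hδ P hP hhc hst))

end Summit.AtomisticToContinuum.Crystallization.Theorems.IsometryAtomsMinimisingLawsHaveAtoms
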